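import Mathlib
import Summits.Ventures.PercRepro.TriangleCapEightThirteenE

/-!
# PercRepro — THREE BELOW THE DIAGONAL, ONE TRIANGLE, EXACTLY ONE OUTER VERTEX: EVERY `k`, `m ≥ 2k − 5`
(p3, gen 37, towards gen 38; part 97)

`S = {u, v, w}` the only triangle, `z` the only outer vertex (no neighbour in `S`), `P = Sᶜ ∖ {z}` the private
vertices (exactly one neighbour in `S` each, the private sets `P_x` independent).  The four blocks of the far count
of `Sᶜ` are EXACT here — `S × S` gives `2 |Sᶜ| + 4` (`z` is far from all six ordered pairs), `S × P` gives
`2 (|Sᶜ| (|Sᶜ| − 1) − Σ_x d_x² − W′)`, `Sᶜ × Sᶜ` gives `|Sᶜ| Q′ − 2 Σ d²` — and with Mantel inside `Sᶜ`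
(`2 Σ d² ≤ |Sᶜ| Q′`) and the private sets independent AWAY FROM `z` (`W′ + Σ_x d_x² ≤ (|Sᶜ| − 1)² + d(z)`) the
deficit sum is `≥ Q′ + 4 |Sᶜ| + 2 = 2m + 2 |Sᶜ| − 2`, which is `≥ 6 (k − 3)` as soon as `2m ≥ 4k − 10`:
**`one_triangle_stability_three_of_one_outer`**: `Σ_v d(v)² + 3 (k − 4) ≤ m k`.  Axioms: standard.
-/

namespace PercRepro

namespace TriangleCap

namespace C047

open Finset

variable {V : Type*} [Fintype V] [DecidableEq V]

omit [Fintype V] [DecidableEq V] in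
/-- The linear assembly of the one-outer-vertex case at `r = 3`. -/
theorem three_one_outer_arith {X F1 F2 T B1 B2 B3 B4 C1 C2 C3 C4 Q' W' sq sqP n m k δ : ℕ}
    (hk : k = n + 3) (hn : 1 ≤ n)
    (hid : 2 * X + (F1 + F2) = 2 * m * k + T) (hT : T ≤ 6) (hfarR : F2 = B1 + B2 + (B3 + B4))
    (hSS : n * 6 ≤ B4 + 2 * (2 * (n - 1))) (hcross : n * (n - 1) ≤ B2 + W' + sq) (hswap : B3 = B2)
    (hB1 : n * Q' ≤ B1 + 2 * sqP) (hMantel : 2 * sqP ≤ n * Q')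
    (hfarS : F1 = C1 + C2 + (C3 + C4)) (hout : 3 * Q' ≤ C4 + 2 * W') (hWQ : W' + δ = Q')
    (htri : W' + sq ≤ (n - 1) * (n - 1) + δ) (hsq : n * (n - 1) = (n - 1) * (n - 1) + (n - 1))
    (hdens : 2 * m = 6 + 2 * (n - 1) + Q') (hm : 4 * k ≤ 2 * m + 10) :
    X + 3 * (k - 4) ≤ m * k := by
  subst hk
  have hmk : 2 * m * (n + 3) = 2 * (m * (n + 3)) := by ring
  omega

/-- **THREE BELOW THE DIAGONAL, ONE TRIANGLE, EXACTLY ONE OUTER VERTEX (every `k`, `2m ≥ 4k − 10`):** `K₄⁻`-free,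
the only triangle `u v w`, `z` outer and every other vertex off the triangle adjacent to one of `u, v, w` ⇒
`Σ_v d(v)² + 3 (k − 4) ≤ m k`. -/
theorem one_triangle_stability_three_of_one_outer (D : SimpleGraph V) [DecidableRel D.Adj] (hK : K4mFree D)
    {u v w : V} (huv : D.Adj u v) (huw : D.Adj u w) (hvw : D.Adj v w)
    (hT : ∀ a b c, D.Adj a b → D.Adj a c → D.Adj b c → a = u ∨ a = v ∨ a = w)
    {z : V} (hz : z ∉ ({u, v, w} : Finset V)) (hz0 : degIn D {u, v, w} z = 0)
    (hq : ∀ y, y ∉ ({u, v, w} : Finset V) → y ≠ z → 1 ≤ degIn D {u, v, w} y)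
    (hm : 4 * Fintype.card V ≤ 2 * D.edgeFinset.card + 10) :
    ∑ v, deg D v * deg D v + 3 * (Fintype.card V - 4) ≤ D.edgeFinset.card * Fintype.card V := by
  set S : Finset V := {u, v, w} with hS
  have h3 : S.card = 3 := card_triple huv.ne huw.ne hvw.ne
  have hcl := clique_triple D huv huw hvw
  have hzR : z ∈ Sᶜ := mem_compl.mpr hz
  set n := Sᶜ.card with hn
  have hn1 : 1 ≤ n := card_pos.mpr ⟨z, hzR⟩
  have hk : Fintype.card V = n + 3 := by
    have := card_add_card_compl S
    omega
  have hQ : adjPairs D S = 6 := by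
    rw [adjPairs_eq_sum_degIn, sum_congr rfl (fun x hx => degIn_self_of_clique D h3 hcl hx), sum_const, h3,
      smul_eq_mul]
  -- every vertex off `S` other than `z` has exactly one neighbour in `S`
  have hs1 : ∀ y ∈ Sᶜ, y ≠ z → degIn D S y = 1 := by
    intro y hy hyz
    have h1 : degIn D S y ≤ 1 := degIn_le_one_of_triangle D hK huv huw hvw (mem_compl.mp hy)
    have h2 : 1 ≤ degIn D S y := hq y (mem_compl.mp hy) hyz
    omega
  have hsum1 : ∑ y ∈ Sᶜ, degIn D S y = n - 1 := by
    rw [← add_sum_erase Sᶜ _ hzR, hz0, zero_add]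
    rw [sum_congr rfl (fun y hy => hs1 y (mem_of_mem_erase hy) (ne_of_mem_erase hy)), sum_const, smul_eq_mul,
      mul_one, card_erase_of_mem hzR]
  have hcomm := sum_degIn_comm D S Sᶜ
  rw [hsum1] at hcomm
  have hdens := two_mul_card_edges_eq_adjPairs_add D S
  rw [hQ, hsum1] at hdens
  set Q' := ∑ y ∈ Sᶜ, degIn D Sᶜ y with hQ'
  set W' := ∑ y ∈ Sᶜ, degIn D S y * degIn D Sᶜ y with hW'
  set δ := degIn D Sᶜ z with hδ
  -- `W′ + d(z) = Q′`
  have hWQ : W' + δ = Q' := by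
    rw [hW', hQ', ← add_sum_erase Sᶜ _ hzR, ← add_sum_erase Sᶜ (fun y => degIn D Sᶜ y) hzR, hz0, zero_mul,
      zero_add]
    rw [sum_congr rfl (fun y hy => by rw [hs1 y (mem_of_mem_erase hy) (ne_of_mem_erase hy), one_mul])]
    ring
  -- `Σ_{x ∈ S} Σ_{y ∈ P_x} d(y) = W′`
  have hWdbl : ∑ x ∈ S, ∑ y ∈ Sᶜ.filter (fun y => D.Adj x y), degIn D Sᶜ y = W' := by
    rw [hW']
    have := double_sum_ite_swap D Sᶜ S (fun y _ => degIn D Sᶜ y)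
    rw [double_sum_ite_left] at this
    rw [← this]
  -- the far count of the vertices off `S`: the four blocks for `Sᶜ`
  have hfarR := sum_far_eq_double D Sᶜ
  rw [double_sum_split Sᶜ, compl_compl] at hfarR
  have hcross := block_cross D Sᶜ
  rw [compl_compl, hcomm, hWdbl, ← hn] at hcross
  have hswap := block_cross_swap D Sᶜ
  rw [compl_compl] at hswap
  have hSS := block_outside D Sᶜ
  rw [compl_compl, ← hn] at hSS
  have hSSdeg : ∑ x ∈ S, degIn D S x = 6 := by
    rw [sum_congr rfl (fun x hx => degIn_self_of_clique D h3 hcl hx), sum_const, h3, smul_eq_mul]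
  have hSSprod : ∑ x ∈ S, degIn D Sᶜ x * degIn D S x = 2 * (n - 1) := by
    have e : ∀ x ∈ S, degIn D Sᶜ x * degIn D S x = degIn D Sᶜ x * 2 := fun x hx => by
      rw [degIn_self_of_clique D h3 hcl hx]
    calc ∑ x ∈ S, degIn D Sᶜ x * degIn D S x = (∑ x ∈ S, degIn D Sᶜ x) * 2 := by
          rw [sum_congr rfl e, sum_mul]
      _ = 2 * (n - 1) := by rw [hcomm, mul_comm]
  rw [hSSdeg, hSSprod] at hSS
  have hB1 := block_inside_self D Sᶜ
  rw [← hn, ← hQ'] at hB1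
  -- the far count of the vertices of `S`: the block `Sᶜ × Sᶜ`
  have hfarS := sum_far_eq_double D S
  rw [double_sum_split S] at hfarS
  have hout := block_outside D S
  rw [h3, ← hQ', ← hW'] at hout
  -- no triangle with a vertex off `S`
  have hnotri : ∀ y, y ∉ S → ∀ y' t, D.Adj y y' → D.Adj y t → D.Adj y' t → False := by
    intro y hy y' t h1 h2 h3'
    have := hT y y' t h1 h2 h3'
    rw [hS] at hy
    simp only [mem_insert, mem_singleton] at hy
    exact hy this
  -- Mantel inside `Sᶜ`
  have hsqP := two_mul_sum_sq_le_of_no_triangle D Sᶜ (fun y hy y' _ t _ h1 h2 h3' =>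
    hnotri y (mem_compl.mp hy) y' t h1 h2 h3')
  rw [← hn, ← hQ'] at hsqP
  -- `z` has no neighbour in `S`
  have hzS : ∀ x ∈ S, ¬ D.Adj x z := by
    intro x hx hxz
    have : 0 < degIn D S z := card_pos.mpr ⟨x, mem_filter.mpr ⟨hx, hxz.symm⟩⟩
    omega
  -- the private sets are independent away from `z`: `d(y) + d_x ≤ n − 1 + [y ∼ z]` for `y ∈ P_x`
  have hpriv : ∀ x ∈ S, ∀ y ∈ Sᶜ, D.Adj x y →
      degIn D Sᶜ y + degIn D Sᶜ x ≤ n - 1 + (if D.Adj y z then 1 else 0) := by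
    intro x hx y hy hxy
    have hdisj : Disjoint (Sᶜ.filter (fun t => D.Adj y t)) (Sᶜ.filter (fun t => D.Adj x t)) := by
      rw [disjoint_left]
      intro t ht1 ht2
      rw [mem_filter] at ht1 ht2
      exact hnotri y (mem_compl.mp hy) x t hxy.symm ht1.2 ht2.2
    have hU := card_union_of_disjoint hdisj
    by_cases hyz : D.Adj y z
    · have := card_le_card (union_subset (filter_subset _ _) (filter_subset _ _) :
        Sᶜ.filter (fun t => D.Adj y t) ∪ Sᶜ.filter (fun t => D.Adj x t) ⊆ Sᶜ)
      rw [hU] at this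
      simp only [hyz, if_true]
      unfold degIn
      omega
    · have hsub : Sᶜ.filter (fun t => D.Adj y t) ∪ Sᶜ.filter (fun t => D.Adj x t) ⊆ Sᶜ.erase z := by
        intro t ht
        rw [mem_union, mem_filter, mem_filter] at ht
        rw [mem_erase]
        rcases ht with ⟨ht1, ht2⟩ | ⟨ht1, ht2⟩
        · exact ⟨fun h => hyz (h ▸ ht2), ht1⟩
        · exact ⟨fun h => hzS x hx (h ▸ ht2), ht1⟩
      have := card_le_card hsub
      rw [hU, card_erase_of_mem hzR] at this
      simp only [hyz, if_false, add_zero]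
      unfold degIn
      omega
  -- `W′ ≤ Σ_x d_x (n − 1 − d_x) + d(z)`
  have hdx : ∀ x ∈ S, degIn D Sᶜ x ≤ n - 1 := by
    intro x hx
    have : Sᶜ.filter (fun t => D.Adj x t) ⊆ Sᶜ.erase z := by
      intro t ht
      rw [mem_filter] at ht
      rw [mem_erase]
      exact ⟨fun h => hzS x hx (h ▸ ht.2), ht.1⟩
    have := card_le_card this
    rw [card_erase_of_mem hzR] at this
    exact this
  have hW'le : W' ≤ ∑ x ∈ S, degIn D Sᶜ x * (n - 1 - degIn D Sᶜ x) + δ := by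
    rw [hW']
    have e1 : ∑ y ∈ Sᶜ, degIn D S y * degIn D Sᶜ y =
        ∑ x ∈ S, ∑ y ∈ Sᶜ, if D.Adj x y then degIn D Sᶜ y else 0 := by
      rw [double_sum_ite_right]
    have e2 : δ = ∑ y ∈ Sᶜ, degIn D S y * (if D.Adj y z then 1 else 0) := by
      rw [hδ]
      rw [← add_sum_erase Sᶜ _ hzR, hz0, zero_mul, zero_add]
      rw [sum_congr rfl (fun y hy => by rw [hs1 y (mem_of_mem_erase hy) (ne_of_mem_erase hy), one_mul])]
      unfold degIn
      rw [card_filter, ← add_sum_erase Sᶜ _ hzR]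
      have : (if D.Adj z z then 1 else 0) = 0 := by simp
      rw [this, zero_add]
      apply sum_congr rfl
      intro y _
      by_cases h : D.Adj y z
      · simp [h, h.symm]
      · have h' : ¬ D.Adj z y := fun h' => h h'.symm
        simp [h, h']
    have e3 : ∑ x ∈ S, degIn D Sᶜ x * (n - 1 - degIn D Sᶜ x) =
        ∑ x ∈ S, ∑ y ∈ Sᶜ, if D.Adj x y then n - 1 - degIn D Sᶜ x else 0 := by
      rw [double_sum_ite_left D S Sᶜ (fun x => n - 1 - degIn D Sᶜ x)]
    rw [e1, e2, e3, ← double_sum_ite_right D S Sᶜ (fun y => if D.Adj y z then 1 else 0), ← sum_add_distrib]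
    apply sum_le_sum
    intro x hx
    rw [← sum_add_distrib]
    apply sum_le_sum
    intro y hy
    by_cases hxy : D.Adj x y
    · simp only [hxy, if_true]
      have h1 := hpriv x hx y hy hxy
      have h2 := hdx x hx
      by_cases hyz : D.Adj y z
      · simp only [hyz, if_true] at h1 ⊢
        omega
      · simp only [hyz, if_false] at h1 ⊢
        omega
    · simp [hxy]
  have hprodsq : ∑ x ∈ S, degIn D Sᶜ x * (n - 1 - degIn D Sᶜ x) + ∑ x ∈ S, degIn D Sᶜ x * degIn D Sᶜ x =
      (n - 1) * (n - 1) := by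
    rw [← sum_add_distrib]
    have e : ∀ x ∈ S, degIn D Sᶜ x * (n - 1 - degIn D Sᶜ x) + degIn D Sᶜ x * degIn D Sᶜ x =
        degIn D Sᶜ x * (n - 1) := by
      intro x hx
      have := hdx x hx
      rw [← mul_add, Nat.sub_add_cancel this]
    rw [sum_congr rfl e, ← sum_mul, hcomm]
  have htri : W' + ∑ x ∈ S, degIn D Sᶜ x * degIn D Sᶜ x ≤ (n - 1) * (n - 1) + δ := by omega
  -- assemble
  have hid := two_mul_sum_deg_sq_add_sum_deficit D
  have h6 := card_triangles3_le_six D hT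
  rw [sum_deficit_eq_sum_far, ← sum_add_sum_compl S (far D), hk] at hid
  have hsq : n * (n - 1) = (n - 1) * (n - 1) + (n - 1) := by
    obtain ⟨p, hp⟩ := Nat.exists_eq_add_of_le hn1
    rw [hp, Nat.add_sub_cancel_left]
    ring
  rw [hk] at hm ⊢
  exact three_one_outer_arith rfl hn1 hid h6 hfarR hSS hcross hswap hB1 hsqP hfarS hout hWQ htri hsq hdens hm

end C047

end TriangleCap

end PercRepro
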